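import Summits.QuantumFields.BalabanUV.Beta.GAN24.TableDressingIdempotent

/-!
# `BalabanUV.Beta.GAN24.TableDressingExpansion` — binder row G-an2-4 ∕ (CONV-C), W-slot CT-route «WC-TL» (RULING R-gan24p1-g24-1, journal l.38843; design
# `gen24/CT-W-DESIGN-v2.md` §2 row (T-DL), idea-1 g30's WARD3 §1 (1.2)): **THE FIFTEEN-TERM EXPANSION OF THE DRESSING DEFECT** — `𝔇 − 1` as the sum over the
# non-empty subsets `S ⊆ {P₂, P₁, L₁, L₂}` of the NESTED one-slot defects `D_S`, plus the ABSORPTION laws `𝔇 ∘ P_s = 𝔇`, `𝔇 ∘ (P_s − 1) = 0` and their dressed-step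
# face `𝒜^E ∘ (P_s − 1) = 0`

NOT IN PRINT; OUR BOOKKEEPING (G-an2-4 crux team (2), leaf prover `b2b-balaban-gan24-formalise-leaf-06`, gen 43; journal [GAN24LEAF06-G43-INTENT4]).  [folklore]
algebra over EXISTING objects (`AxialDressingRooted.coProjBmAtK ∕ legCo₁BmAt ∕ legCo₂BmAt ∕ dressKBmAt`, the table dressing `𝔇` of `LinT2CoDressed.lin4_coDressKBmAt`,
VERBATIM the lambda of `TableDressingDefect` ∕ `TableDressingProjector` ∕ `TableDressingIdempotent`); 0 `def`, 0 cite, 0 `def … : Prop`, 0 sorry.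

WHAT IT PROVES (the four one-variable dressings written as lambdas: `P₂ Y := (κ u ↦ coProjBmAtK ρ N (Y κ u))` (second source slot), `P₁ Y := (κ u κ′ u′ ↦ coProjBmAtK ρ N
(κ₁ u₁ ↦ Y κ₁ u₁ κ′ u′) κ u)` (first source slot), `L₁ Y := (κ u κ′ u′ ↦ legCo₁BmAt ρ N (Y κ u κ′ u′))`, `L₂ Y := (κ u κ′ u′ ↦ legCo₂BmAt ρ N (Y κ u κ′ u′))` (the two kernel
legs), `𝔇 = L₂ L₁ P₁ P₂` (`TableDressingDefect.tableDress_eq_legs`); the ONE-SLOT DEFECT of slot `s` on a table `Z` is `P_s Z − Z`, and for `∅ ≠ S ⊆ {2, 1, L₁, L₂}` the NESTED defect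
`D_S Y` applies the one-slot defects of `S` in the fixed order `2, 1, L₁, L₂` (e.g. `D_{2,1} Y = P₁ (P₂ Y − Y) − (P₂ Y − Y)`)):
§1 [folklore] `sub_self_eq_fifteen` — PURE ALGEBRA on any `AddCommGroup`: for maps `P₂ P₁ L₁ L₂` with `P₁ L₁ L₂` additive over differences,
   `L₂ (L₁ (P₁ (P₂ y))) − y = Σ_{S ≠ ∅} D_S y` (fifteen nested terms; NO commutation is used — the order inside each nest is the composition order).
§2 [folklore] ADDITIVITY over differences of the stencil-slot window `coProjBmAtK_sub`, of the four table dressings `coProj_snd_sub ∕ coProj_fst_sub ∕ legCo₁T_sub ∕ legCo₂T_sub`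
   (with the `MKer` forms `legCo₁_sub ∕ legCo₂_sub ∕ dressKBmAt_sub`) and of `𝔇` itself, `tableDress_sub` — finite window sums (any `ρ N`).
§3 **`tableDress_sub_self_eq_fifteen`** — T-DL (1.2) ON `Tab d` (ANY root offset `ρ`, ANY `N`, ANY table; no decay hypothesis): `𝔇 Y − Y = Σ_{S ≠ ∅} D_S Y`, the fifteen nests
   written out; `tableDress_sub_self_eq_fifteen_of_letters` — the same with the four dressings as LETTERS `P₂ P₁ L₁ L₂ : Tab d → Tab d` bound by `rfl`-dischargeable equations
   (the readable form; `subst` and it is §3's instance).  Each factor `P_s Z − Z` of a nest is ONE one-slot defect, which leaf-02's `CoProjBmDivFree.coProjBmAt_eq_self_sub_tsum_div` ∕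
   `TableDressingDefect.coProj_snd_sub_self_apply ∕ coProj_fst_sub_self_apply ∕ legCo₁_sub_self_inl ∕ legCo₂_sub_self_inl` rewrite as `−ι_s (Δ_s Z)` — giving WARD3's signed form
   `(𝔇 − 1) Y = Σ_{S ≠ ∅} (−1)^{|S|} ι_S Δ_S Y` once the insertions `ι_s` and divergences `Δ_{s′}` in DIFFERENT variables are commuted (not done here).
§4 ABSORPTION (in-block root `ρ = toSite r`, `1 ≤ N`, ANY table): `tableDress_coProj_snd ∕ _coProj_fst ∕ _legCo₁ ∕ _legCo₂ ∕ _dress`: `𝔇 (P_s Y) = 𝔇 Y` for each of the four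
   one-variable dressings and for the kernel dressing `L = L₂ L₁` (`TableDressingIdempotent` §1 commutations + `TableDressingProjector` §2 idempotents); hence
   `tableDress_slotDefect_snd ∕ _fst ∕ _legCo₁ ∕ _legCo₂ ∕ _dress_eq_zero`: **`𝔇 (P_s Y − Y) = 0`** — `𝔇` KILLS EVERY ONE-SLOT DEFECT (and hence, by §2, every nest
   `D_S Y`, `S ≠ ∅`, of §3 — the `|S| ≥ 2` cases are not spelled out).
§5 (decaying `K` at rate `m > 0`, `LocStencil₂ Y CY m`, in-block root, `1 ≤ N`, any `c`) **`lin4_coDressKBmAt_slotDefect_snd ∕ _fst ∕ _dress_eq_zero`**: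
   `lin4 c (coDressKBmAt ρ N K) N (P_s Y − Y) = 0` for the two source slots and the kernel dressing — idea-1 g31's «(E1) weak form is VACUOUS» (journal l.38805) as a kernel
   fact: the DRESSED linear step `𝒜^E = 𝒜^B ∘ 𝔇` (`LinT2CoDressed.lin4_coDressKBmAt`) annihilates every one-slot defect, not only the full defect `𝔇 Y − Y`
   (`TableDressingIdempotent.lin4_coDressKBmAt_defect_eq_zero`).
Asserts NOTHING about Bałaban's tables; 0 estimate; decides nothing about (Q-R) ∕ (C); NEVER «G-an2-4 closed» as (CONV-C); NOT D1, NOT `BetaPertH`, NOT continuum, NOT Clay.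
2026-08-22.
-/

noncomputable section

open Finset
open scoped BigOperators
open Literature.MathematicalPhysics.QuantumFieldTheory
open Literature.MathematicalPhysics.QuantumFieldTheory.Balaban1983to89
open Literature.MathematicalPhysics.QuantumFieldTheory.Balaban1983to89.Beta
open ExpKernelCalculus (MKer Site Decays)
open AffineAveraging (box toSite unitVec)
open OneStepResolventKernel (Fib)
open BalabanCompositeJets (LocStencil₂)
open Summit.QuantumFields.BalabanUV.Beta.AxialDressingRooted (cube pmBm coProjBmAt coProjBmAt_apply coProjBmAtK coProjBmAtK_eval coDressKBmAt dressKBmAt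
  legCo₁BmAt legCo₂BmAt legCo₁BmAt_inl legCo₁BmAt_inr legCo₂BmAt_inl legCo₂BmAt_inr dressKBmAt_eq_legs cKb cKb_nonneg cWb cWb_nonneg)
open Summit.QuantumFields.BalabanUV.Beta.GAN24.BiStencilZeroMode (Tab)
open Summit.QuantumFields.BalabanUV.Beta.GAN24.T2RecursionAffine (lin4)
open Summit.QuantumFields.BalabanUV.Beta.GAN24.LinT2CoDressed (lin4_coDressKBmAt locStencil₂_coProj_snd locStencil₂_coProj_fst locStencil₂_dress)
open Summit.QuantumFields.BalabanUV.Beta.GAN24.Lin4Additive (lin4_sub)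
open Summit.QuantumFields.BalabanUV.Beta.GAN24.TableDressingDefect (tableDress_eq_legs locStencil₂_tableDress locStencil₂_diff bdd_of_locStencil₂)
open Summit.QuantumFields.BalabanUV.Beta.GAN24.TableDressingProjector (coProj_snd_idem coProj_fst_idem legCo₁_idem legCo₂_idem)
open Summit.QuantumFields.BalabanUV.Beta.GAN24.TableDressingIdempotent (coProj_snd_fst_comm coProj_snd_legCo₁_comm coProj_snd_legCo₂_comm coProj_fst_legCo₁_comm
  coProj_fst_legCo₂_comm legCo₁_legCo₂_comm coProjBmAtK_idem coProjBmAtK_legCo₁_comm coProjBmAtK_legCo₂_comm coProjBmAtK_dressKBmAt_comm dressKBmAt_idem tableDress_idem)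

namespace Summit.QuantumFields.BalabanUV.Beta.GAN24.TableDressingExpansion

variable {d : ℕ}

/-! ## §1 Pure algebra: the fifteen-term expansion of a fourfold composition -/

/-- [folklore] **THE FIFTEEN-TERM EXPANSION** (pure algebra on an additive commutative group): for maps `P₂ P₁ L₁ L₂ : G → G` with `P₁`, `L₁`, `L₂` additive over
differences, `L₂ (L₁ (P₁ (P₂ y))) − y = Σ_{∅ ≠ S ⊆ {2,1,L₁,L₂}} D_S y`, `D_S` the nested one-slot defects in the composition order (`P₂` innermost).  No commutation is used. -/
theorem sub_self_eq_fifteen {G : Type*} [AddCommGroup G] (P₂ P₁ L₁ L₂ : G → G)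
    (h₁ : ∀ a b, P₁ (a - b) = P₁ a - P₁ b) (hL₁ : ∀ a b, L₁ (a - b) = L₁ a - L₁ b) (hL₂ : ∀ a b, L₂ (a - b) = L₂ a - L₂ b) (y : G) :
    L₂ (L₁ (P₁ (P₂ y))) - y =
      -- `D_{2}`
        (P₂ y - y)
      -- `D_{1}`
      + (P₁ y - y)
      -- `D_{L₁}`
      + (L₁ y - y)
      -- `D_{L₂}`
      + (L₂ y - y)
      -- `D_{2,1}`
      + (P₁ (P₂ y - y) - (P₂ y - y))
      -- `D_{2,L₁}`
      + (L₁ (P₂ y - y) - (P₂ y - y))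
      -- `D_{2,L₂}`
      + (L₂ (P₂ y - y) - (P₂ y - y))
      -- `D_{1,L₁}`
      + (L₁ (P₁ y - y) - (P₁ y - y))
      -- `D_{1,L₂}`
      + (L₂ (P₁ y - y) - (P₁ y - y))
      -- `D_{L₁,L₂}`
      + (L₂ (L₁ y - y) - (L₁ y - y))
      -- `D_{2,1,L₁}`
      + (L₁ (P₁ (P₂ y - y) - (P₂ y - y)) - (P₁ (P₂ y - y) - (P₂ y - y)))
      -- `D_{2,1,L₂}`
      + (L₂ (P₁ (P₂ y - y) - (P₂ y - y)) - (P₁ (P₂ y - y) - (P₂ y - y)))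
      -- `D_{2,L₁,L₂}`
      + (L₂ (L₁ (P₂ y - y) - (P₂ y - y)) - (L₁ (P₂ y - y) - (P₂ y - y)))
      -- `D_{1,L₁,L₂}`
      + (L₂ (L₁ (P₁ y - y) - (P₁ y - y)) - (L₁ (P₁ y - y) - (P₁ y - y)))
      -- `D_{2,1,L₁,L₂}`
      + (L₂ (L₁ (P₁ (P₂ y - y) - (P₂ y - y)) - (P₁ (P₂ y - y) - (P₂ y - y))) - (L₁ (P₁ (P₂ y - y) - (P₂ y - y)) - (P₁ (P₂ y - y) - (P₂ y - y)))) := by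
  simp only [h₁, hL₁, hL₂]
  abel

/-! ## §2 Additivity of the four dressings and of `𝔇` over differences -/

variable (ρ : Fin (d + 1) → ℤ) (N : ℕ)

/-- [folklore] The stencil-slot window `Πᵀ_bm` is additive over differences of slot families (finite window sums). -/
theorem coProjBmAtK_sub (S T : Fin (d + 1) → (Fin (d + 1) → ℤ) → MKer (d + 1) (Fib d)) :
    coProjBmAtK ρ N (S - T) = coProjBmAtK ρ N S - coProjBmAtK ρ N T := by
  funext κ u x z a b
  simp only [Pi.sub_apply, coProjBmAtK_eval, coProjBmAt_apply, mul_sub, Finset.sum_sub_distrib]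

/-- [folklore] The same, read at one slot index with the difference written pointwise (the higher-order pattern `simp` meets under binders). -/
theorem coProjBmAtK_sub_apply (S T : Fin (d + 1) → (Fin (d + 1) → ℤ) → MKer (d + 1) (Fib d)) (κ : Fin (d + 1)) (u : Fin (d + 1) → ℤ) :
    coProjBmAtK ρ N (fun κ₁ u₁ => S κ₁ u₁ - T κ₁ u₁) κ u = coProjBmAtK ρ N S κ u - coProjBmAtK ρ N T κ u := by
  have e : (fun κ₁ u₁ => S κ₁ u₁ - T κ₁ u₁) = S - T := rfl
  rw [e, coProjBmAtK_sub, Pi.sub_apply, Pi.sub_apply]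

/-- [folklore] The second-source-slot dressing `P₂` is additive over differences of tables. -/
theorem coProj_snd_sub (A B : Tab d) :
    (fun κ u => coProjBmAtK ρ N ((A - B) κ u)) = (fun κ u => coProjBmAtK ρ N (A κ u)) - (fun κ u => coProjBmAtK ρ N (B κ u)) := by
  funext κ u κ' u' x z a b
  simp only [Pi.sub_apply, coProjBmAtK_eval, coProjBmAt_apply, mul_sub, Finset.sum_sub_distrib]

/-- [folklore] The first-source-slot dressing `P₁` is additive over differences of tables. -/
theorem coProj_fst_sub (A B : Tab d) :
    (fun κ u κ' u' => coProjBmAtK ρ N (fun κ₁ u₁ => (A - B) κ₁ u₁ κ' u') κ u)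
      = (fun κ u κ' u' => coProjBmAtK ρ N (fun κ₁ u₁ => A κ₁ u₁ κ' u') κ u) - (fun κ u κ' u' => coProjBmAtK ρ N (fun κ₁ u₁ => B κ₁ u₁ κ' u') κ u) := by
  funext κ u κ' u' x z a b
  simp only [Pi.sub_apply, coProjBmAtK_eval, coProjBmAt_apply, mul_sub, Finset.sum_sub_distrib]

/-- [folklore] The first-leg dressing is additive over differences of kernels. -/
theorem legCo₁_sub (V W : MKer (d + 1) (Fib d)) : legCo₁BmAt ρ N (V - W) = legCo₁BmAt ρ N V - legCo₁BmAt ρ N W := by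
  funext x z a b
  rcases a with α | m
  · simp only [Pi.sub_apply, legCo₁BmAt_inl, coProjBmAt_apply, mul_sub, Finset.sum_sub_distrib]
  · simp only [Pi.sub_apply, legCo₁BmAt_inr]

/-- [folklore] The second-leg dressing is additive over differences of kernels. -/
theorem legCo₂_sub (V W : MKer (d + 1) (Fib d)) : legCo₂BmAt ρ N (V - W) = legCo₂BmAt ρ N V - legCo₂BmAt ρ N W := by
  funext x z a b
  rcases b with β₀ | m
  · simp only [Pi.sub_apply, legCo₂BmAt_inl, coProjBmAt_apply, mul_sub, Finset.sum_sub_distrib]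
  · simp only [Pi.sub_apply, legCo₂BmAt_inr]

/-- [folklore] The first-leg dressing of a TABLE, `L₁`, is additive over differences. -/
theorem legCo₁T_sub (A B : Tab d) :
    (fun κ u κ' u' => legCo₁BmAt ρ N ((A - B) κ u κ' u'))
      = (fun κ u κ' u' => legCo₁BmAt ρ N (A κ u κ' u')) - (fun κ u κ' u' => legCo₁BmAt ρ N (B κ u κ' u')) := by
  funext κ u κ' u'
  simp only [Pi.sub_apply, legCo₁_sub]

/-- [folklore] The second-leg dressing of a TABLE, `L₂`, is additive over differences. -/
theorem legCo₂T_sub (A B : Tab d) :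
    (fun κ u κ' u' => legCo₂BmAt ρ N ((A - B) κ u κ' u'))
      = (fun κ u κ' u' => legCo₂BmAt ρ N (A κ u κ' u')) - (fun κ u κ' u' => legCo₂BmAt ρ N (B κ u κ' u')) := by
  funext κ u κ' u'
  simp only [Pi.sub_apply, legCo₂_sub]

/-- [folklore] The kernel dressing `dressKBmAt = L₂ ∘ L₁` is additive over differences of kernels (an2's `dressKBmAt_eq_legs` + the two legs). -/
theorem dressKBmAt_sub (V W : MKer (d + 1) (Fib d)) : dressKBmAt ρ N (V - W) = dressKBmAt ρ N V - dressKBmAt ρ N W := by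
  rw [dressKBmAt_eq_legs, dressKBmAt_eq_legs, dressKBmAt_eq_legs, legCo₁_sub, legCo₂_sub]

/-- NOT IN PRINT; OUR BOOKKEEPING.  **THE TABLE DRESSING `𝔇` IS ADDITIVE OVER DIFFERENCES** (any `ρ N`): `𝔇 (A − B) = 𝔇 A − 𝔇 B`. -/
theorem tableDress_sub (A B : Tab d) :
    (fun κ u κ' u' => dressKBmAt ρ N (coProjBmAtK ρ N (fun κ₁ u₁ => coProjBmAtK ρ N ((A - B) κ₁ u₁) κ' u') κ u))
      = (fun κ u κ' u' => dressKBmAt ρ N (coProjBmAtK ρ N (fun κ₁ u₁ => coProjBmAtK ρ N (A κ₁ u₁) κ' u') κ u))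
        - (fun κ u κ' u' => dressKBmAt ρ N (coProjBmAtK ρ N (fun κ₁ u₁ => coProjBmAtK ρ N (B κ₁ u₁) κ' u') κ u)) := by
  funext κ u κ' u'
  simp only [Pi.sub_apply, coProjBmAtK_sub, coProjBmAtK_sub_apply, dressKBmAt_sub]

/-! ## §3 T-DL (1.2): the fifteen-term expansion of `𝔇 − 1` on `Tab d` -/

/-- NOT IN PRINT; OUR BOOKKEEPING.  **T-DL — THE FIFTEEN-TERM EXPANSION OF THE DRESSING DEFECT** (ANY root offset `ρ`, ANY `N`, ANY table `Y : Tab d`):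
`𝔇 Y − Y = Σ_{∅ ≠ S ⊆ {2, 1, L₁, L₂}} D_S Y`, where `D_S Y` nests the one-slot defects `Z ↦ P_s Z − Z` of the slots of `S` in the order `2, 1, L₁, L₂` (each written out as a
lambda; e.g. the term tagged `D_{2,1}` is `P₁ (P₂ Y − Y) − (P₂ Y − Y)`).  §1 with §2's additivity of `P₁`, `L₁`, `L₂`; the telescoped four-term form is
`TableDressingDefect.tableDress_sub_self`. -/
theorem tableDress_sub_self_eq_fifteen (Y : Tab d) :
    (fun κ u κ' u' => dressKBmAt ρ N (coProjBmAtK ρ N (fun κ₁ u₁ => coProjBmAtK ρ N (Y κ₁ u₁) κ' u') κ u)) - Y =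
      -- `D_{2}`
        ((fun κ u => coProjBmAtK ρ N (Y κ u)) - Y)
      -- `D_{1}`
      + ((fun κ u κ' u' => coProjBmAtK ρ N (fun κ₁ u₁ => Y κ₁ u₁ κ' u') κ u) - Y)
      -- `D_{L₁}`
      + ((fun κ u κ' u' => legCo₁BmAt ρ N (Y κ u κ' u')) - Y)
      -- `D_{L₂}`
      + ((fun κ u κ' u' => legCo₂BmAt ρ N (Y κ u κ' u')) - Y)
      -- `D_{2,1}`
      + ((fun κ u κ' u' => coProjBmAtK ρ N (fun κ₁ u₁ => ((fun κ u => coProjBmAtK ρ N (Y κ u)) - Y) κ₁ u₁ κ' u') κ u) - ((fun κ u => coProjBmAtK ρ N (Y κ u)) - Y))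
      -- `D_{2,L₁}`
      + ((fun κ u κ' u' => legCo₁BmAt ρ N (((fun κ u => coProjBmAtK ρ N (Y κ u)) - Y) κ u κ' u')) - ((fun κ u => coProjBmAtK ρ N (Y κ u)) - Y))
      -- `D_{2,L₂}`
      + ((fun κ u κ' u' => legCo₂BmAt ρ N (((fun κ u => coProjBmAtK ρ N (Y κ u)) - Y) κ u κ' u')) - ((fun κ u => coProjBmAtK ρ N (Y κ u)) - Y))
      -- `D_{1,L₁}`
      + ((fun κ u κ' u' => legCo₁BmAt ρ N (((fun κ u κ' u' => coProjBmAtK ρ N (fun κ₁ u₁ => Y κ₁ u₁ κ' u') κ u) - Y) κ u κ' u'))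
          - ((fun κ u κ' u' => coProjBmAtK ρ N (fun κ₁ u₁ => Y κ₁ u₁ κ' u') κ u) - Y))
      -- `D_{1,L₂}`
      + ((fun κ u κ' u' => legCo₂BmAt ρ N (((fun κ u κ' u' => coProjBmAtK ρ N (fun κ₁ u₁ => Y κ₁ u₁ κ' u') κ u) - Y) κ u κ' u'))
          - ((fun κ u κ' u' => coProjBmAtK ρ N (fun κ₁ u₁ => Y κ₁ u₁ κ' u') κ u) - Y))
      -- `D_{L₁,L₂}`
      + ((fun κ u κ' u' => legCo₂BmAt ρ N (((fun κ u κ' u' => legCo₁BmAt ρ N (Y κ u κ' u')) - Y) κ u κ' u')) - ((fun κ u κ' u' => legCo₁BmAt ρ N (Y κ u κ' u')) - Y))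
      -- `D_{2,1,L₁}`
      + ((fun κ u κ' u' => legCo₁BmAt ρ N (((fun κ u κ' u' => coProjBmAtK ρ N (fun κ₁ u₁ => ((fun κ u => coProjBmAtK ρ N (Y κ u)) - Y) κ₁ u₁ κ' u') κ u) - ((fun κ u => coProjBmAtK ρ N (Y κ u)) - Y)) κ u κ' u'))
          - ((fun κ u κ' u' => coProjBmAtK ρ N (fun κ₁ u₁ => ((fun κ u => coProjBmAtK ρ N (Y κ u)) - Y) κ₁ u₁ κ' u') κ u) - ((fun κ u => coProjBmAtK ρ N (Y κ u)) - Y)))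
      -- `D_{2,1,L₂}`
      + ((fun κ u κ' u' => legCo₂BmAt ρ N (((fun κ u κ' u' => coProjBmAtK ρ N (fun κ₁ u₁ => ((fun κ u => coProjBmAtK ρ N (Y κ u)) - Y) κ₁ u₁ κ' u') κ u) - ((fun κ u => coProjBmAtK ρ N (Y κ u)) - Y)) κ u κ' u'))
          - ((fun κ u κ' u' => coProjBmAtK ρ N (fun κ₁ u₁ => ((fun κ u => coProjBmAtK ρ N (Y κ u)) - Y) κ₁ u₁ κ' u') κ u) - ((fun κ u => coProjBmAtK ρ N (Y κ u)) - Y)))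
      -- `D_{2,L₁,L₂}`
      + ((fun κ u κ' u' => legCo₂BmAt ρ N (((fun κ u κ' u' => legCo₁BmAt ρ N (((fun κ u => coProjBmAtK ρ N (Y κ u)) - Y) κ u κ' u')) - ((fun κ u => coProjBmAtK ρ N (Y κ u)) - Y)) κ u κ' u'))
          - ((fun κ u κ' u' => legCo₁BmAt ρ N (((fun κ u => coProjBmAtK ρ N (Y κ u)) - Y) κ u κ' u')) - ((fun κ u => coProjBmAtK ρ N (Y κ u)) - Y)))
      -- `D_{1,L₁,L₂}`
      + ((fun κ u κ' u' => legCo₂BmAt ρ N (((fun κ u κ' u' => legCo₁BmAt ρ N (((fun κ u κ' u' => coProjBmAtK ρ N (fun κ₁ u₁ => Y κ₁ u₁ κ' u') κ u) - Y) κ u κ' u')) - ((fun κ u κ' u' => coProjBmAtK ρ N (fun κ₁ u₁ => Y κ₁ u₁ κ' u') κ u) - Y)) κ u κ' u'))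
          - ((fun κ u κ' u' => legCo₁BmAt ρ N (((fun κ u κ' u' => coProjBmAtK ρ N (fun κ₁ u₁ => Y κ₁ u₁ κ' u') κ u) - Y) κ u κ' u')) - ((fun κ u κ' u' => coProjBmAtK ρ N (fun κ₁ u₁ => Y κ₁ u₁ κ' u') κ u) - Y)))
      -- `D_{2,1,L₁,L₂}`
      + ((fun κ u κ' u' => legCo₂BmAt ρ N (((fun κ u κ' u' => legCo₁BmAt ρ N (((fun κ u κ' u' => coProjBmAtK ρ N (fun κ₁ u₁ => ((fun κ u => coProjBmAtK ρ N (Y κ u)) - Y) κ₁ u₁ κ' u') κ u) - ((fun κ u => coProjBmAtK ρ N (Y κ u)) - Y)) κ u κ' u')) - ((fun κ u κ' u' => coProjBmAtK ρ N (fun κ₁ u₁ => ((fun κ u => coProjBmAtK ρ N (Y κ u)) - Y) κ₁ u₁ κ' u') κ u) - ((fun κ u => coProjBmAtK ρ N (Y κ u)) - Y))) κ u κ' u'))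
          - ((fun κ u κ' u' => legCo₁BmAt ρ N (((fun κ u κ' u' => coProjBmAtK ρ N (fun κ₁ u₁ => ((fun κ u => coProjBmAtK ρ N (Y κ u)) - Y) κ₁ u₁ κ' u') κ u) - ((fun κ u => coProjBmAtK ρ N (Y κ u)) - Y)) κ u κ' u')) - ((fun κ u κ' u' => coProjBmAtK ρ N (fun κ₁ u₁ => ((fun κ u => coProjBmAtK ρ N (Y κ u)) - Y) κ₁ u₁ κ' u') κ u) - ((fun κ u => coProjBmAtK ρ N (Y κ u)) - Y)))) := by
  -- pointwise in the four slot indices: every dressing distributes over the differences (§2), then both sides are the same ℤ-combination of the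
  -- sixteen compositions `L₂^a L₁^b P₁^c P₂^e Y`
  funext κ u κ' u'
  simp only [Pi.sub_apply, Pi.add_apply, dressKBmAt_eq_legs, coProjBmAtK_sub_apply, legCo₁_sub, legCo₂_sub]
  abel

/-- NOT IN PRINT; OUR BOOKKEEPING.  **T-DL IN LETTERS** (the readable form of `tableDress_sub_self_eq_fifteen`): with the four one-variable dressings bound as letters
`P₂ P₁ L₁ L₂ : Tab d → Tab d` (equations dischargeable by `rfl`), `𝔇 Y − Y = Σ_{S ≠ ∅} D_S Y` with `D_{2,1} Y = P₁ (P₂ Y − Y) − (P₂ Y − Y)` etc. -/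
theorem tableDress_sub_self_eq_fifteen_of_letters (P₂ P₁ L₁ L₂ : Tab d → Tab d)
    (h₂ : P₂ = fun Y => fun κ u => coProjBmAtK ρ N (Y κ u))
    (h₁ : P₁ = fun Y => fun κ u κ' u' => coProjBmAtK ρ N (fun κ₁ u₁ => Y κ₁ u₁ κ' u') κ u)
    (hL₁ : L₁ = fun Y => fun κ u κ' u' => legCo₁BmAt ρ N (Y κ u κ' u'))
    (hL₂ : L₂ = fun Y => fun κ u κ' u' => legCo₂BmAt ρ N (Y κ u κ' u')) (Y : Tab d) :
    (fun κ u κ' u' => dressKBmAt ρ N (coProjBmAtK ρ N (fun κ₁ u₁ => coProjBmAtK ρ N (Y κ₁ u₁) κ' u') κ u)) - Y =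
      -- `D_{2}`
        (P₂ Y - Y)
      -- `D_{1}`
      + (P₁ Y - Y)
      -- `D_{L₁}`
      + (L₁ Y - Y)
      -- `D_{L₂}`
      + (L₂ Y - Y)
      -- `D_{2,1}`
      + (P₁ (P₂ Y - Y) - (P₂ Y - Y))
      -- `D_{2,L₁}`
      + (L₁ (P₂ Y - Y) - (P₂ Y - Y))
      -- `D_{2,L₂}`
      + (L₂ (P₂ Y - Y) - (P₂ Y - Y))
      -- `D_{1,L₁}`
      + (L₁ (P₁ Y - Y) - (P₁ Y - Y))
      -- `D_{1,L₂}`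
      + (L₂ (P₁ Y - Y) - (P₁ Y - Y))
      -- `D_{L₁,L₂}`
      + (L₂ (L₁ Y - Y) - (L₁ Y - Y))
      -- `D_{2,1,L₁}`
      + (L₁ (P₁ (P₂ Y - Y) - (P₂ Y - Y)) - (P₁ (P₂ Y - Y) - (P₂ Y - Y)))
      -- `D_{2,1,L₂}`
      + (L₂ (P₁ (P₂ Y - Y) - (P₂ Y - Y)) - (P₁ (P₂ Y - Y) - (P₂ Y - Y)))
      -- `D_{2,L₁,L₂}`
      + (L₂ (L₁ (P₂ Y - Y) - (P₂ Y - Y)) - (L₁ (P₂ Y - Y) - (P₂ Y - Y)))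
      -- `D_{1,L₁,L₂}`
      + (L₂ (L₁ (P₁ Y - Y) - (P₁ Y - Y)) - (L₁ (P₁ Y - Y) - (P₁ Y - Y)))
      -- `D_{2,1,L₁,L₂}`
      + (L₂ (L₁ (P₁ (P₂ Y - Y) - (P₂ Y - Y)) - (P₁ (P₂ Y - Y) - (P₂ Y - Y))) - (L₁ (P₁ (P₂ Y - Y) - (P₂ Y - Y)) - (P₁ (P₂ Y - Y) - (P₂ Y - Y)))) := by
  subst h₂ h₁ hL₁ hL₂
  funext κ u κ' u'
  simp only [Pi.sub_apply, Pi.add_apply, dressKBmAt_eq_legs, coProjBmAtK_sub_apply, legCo₁_sub, legCo₂_sub]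
  abel

/-! ## §4 Absorption: `𝔇 ∘ P_s = 𝔇` and `𝔇` kills every one-slot defect -/

variable {N : ℕ}

/-- NOT IN PRINT; OUR BOOKKEEPING.  **`𝔇` ABSORBS THE SECOND-SOURCE-SLOT DRESSING**: `𝔇 (P₂ Y) = 𝔇 Y` (in-block root, `1 ≤ N`, any table; `P₂` is a projector). -/
theorem tableDress_coProj_snd (hN : 1 ≤ N) {r : Fin (d + 1) → ℕ} (hr : r ∈ box (d + 1) N) (Y : Tab d) :
    (fun κ u κ' u' => dressKBmAt (toSite r) N (coProjBmAtK (toSite r) N (fun κ₁ u₁ => coProjBmAtK (toSite r) N ((fun κ u => coProjBmAtK (toSite r) N (Y κ u)) κ₁ u₁) κ' u') κ u))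
      = (fun κ u κ' u' => dressKBmAt (toSite r) N (coProjBmAtK (toSite r) N (fun κ₁ u₁ => coProjBmAtK (toSite r) N (Y κ₁ u₁) κ' u') κ u)) := by
  funext κ u κ' u'
  show dressKBmAt (toSite r) N (coProjBmAtK (toSite r) N (fun κ₁ u₁ => coProjBmAtK (toSite r) N (coProjBmAtK (toSite r) N (Y κ₁ u₁)) κ' u') κ u) = _
  simp only [coProjBmAtK_idem hN hr]

/-- NOT IN PRINT; OUR BOOKKEEPING.  **`𝔇` ABSORBS THE FIRST-SOURCE-SLOT DRESSING**: `𝔇 (P₁ Y) = 𝔇 Y` (in-block root, `1 ≤ N`; `P₂ P₁ = P₁ P₂` and `P₁` is a projector). -/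
theorem tableDress_coProj_fst (hN : 1 ≤ N) {r : Fin (d + 1) → ℕ} (hr : r ∈ box (d + 1) N) (Y : Tab d) :
    (fun κ u κ' u' => dressKBmAt (toSite r) N (coProjBmAtK (toSite r) N (fun κ₁ u₁ => coProjBmAtK (toSite r) N ((fun κ u κ' u' => coProjBmAtK (toSite r) N (fun κ₁ u₁ => Y κ₁ u₁ κ' u') κ u) κ₁ u₁) κ' u') κ u))
      = (fun κ u κ' u' => dressKBmAt (toSite r) N (coProjBmAtK (toSite r) N (fun κ₁ u₁ => coProjBmAtK (toSite r) N (Y κ₁ u₁) κ' u') κ u)) := by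
  funext κ u κ' u'
  show dressKBmAt (toSite r) N (coProjBmAtK (toSite r) N (fun κ₁ u₁ =>
      coProjBmAtK (toSite r) N (fun κ₂ u₂ => coProjBmAtK (toSite r) N (fun κ₃ u₃ => Y κ₃ u₃ κ₂ u₂) κ₁ u₁) κ' u') κ u) = _
  -- `P₂ (P₁ Y) = P₁ (P₂ Y)` read at `(κ₁, u₁; κ′, u′)` (`TableDressingIdempotent.coProj_snd_fst_comm`), then `P₁ P₁ = P₁` (`coProjBmAtK_idem`)
  have e : ∀ (κ₁ : Fin (d + 1)) (u₁ : Fin (d + 1) → ℤ),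
      coProjBmAtK (toSite r) N (fun κ₂ u₂ => coProjBmAtK (toSite r) N (fun κ₃ u₃ => Y κ₃ u₃ κ₂ u₂) κ₁ u₁) κ' u'
        = coProjBmAtK (toSite r) N (fun κ₃ u₃ => coProjBmAtK (toSite r) N (Y κ₃ u₃) κ' u') κ₁ u₁ :=
    fun κ₁ u₁ => congrFun (congrFun (congrFun (congrFun (coProj_snd_fst_comm (toSite r) N Y) κ₁) u₁) κ') u'
  simp only [e]
  congr 1
  exact congrFun (congrFun (coProjBmAtK_idem hN hr (fun κ₃ u₃ => coProjBmAtK (toSite r) N (Y κ₃ u₃) κ' u')) κ) u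

/-- NOT IN PRINT; OUR BOOKKEEPING.  **`𝔇` ABSORBS THE FIRST-LEG DRESSING**: `𝔇 (L₁ Y) = 𝔇 Y` (in-block root, `1 ≤ N`; `L₁` commutes with `P₂`, `P₁` and is a projector inside
`dressKBmAt = L₂ L₁`). -/
theorem tableDress_legCo₁ (hN : 1 ≤ N) {r : Fin (d + 1) → ℕ} (hr : r ∈ box (d + 1) N) (Y : Tab d) :
    (fun κ u κ' u' => dressKBmAt (toSite r) N (coProjBmAtK (toSite r) N (fun κ₁ u₁ => coProjBmAtK (toSite r) N ((fun κ u κ' u' => legCo₁BmAt (toSite r) N (Y κ u κ' u')) κ₁ u₁) κ' u') κ u))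
      = (fun κ u κ' u' => dressKBmAt (toSite r) N (coProjBmAtK (toSite r) N (fun κ₁ u₁ => coProjBmAtK (toSite r) N (Y κ₁ u₁) κ' u') κ u)) := by
  funext κ u κ' u'
  show dressKBmAt (toSite r) N (coProjBmAtK (toSite r) N (fun κ₁ u₁ => coProjBmAtK (toSite r) N (fun κ₂ u₂ => legCo₁BmAt (toSite r) N (Y κ₁ u₁ κ₂ u₂)) κ' u') κ u) = _
  simp only [coProjBmAtK_legCo₁_comm]
  rw [dressKBmAt_eq_legs, dressKBmAt_eq_legs, legCo₁_idem hN hr]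

/-- NOT IN PRINT; OUR BOOKKEEPING.  **`𝔇` ABSORBS THE SECOND-LEG DRESSING**: `𝔇 (L₂ Y) = 𝔇 Y` (in-block root, `1 ≤ N`; `L₂` commutes with `P₂`, `P₁`, `L₁` and is a projector). -/
theorem tableDress_legCo₂ (hN : 1 ≤ N) {r : Fin (d + 1) → ℕ} (hr : r ∈ box (d + 1) N) (Y : Tab d) :
    (fun κ u κ' u' => dressKBmAt (toSite r) N (coProjBmAtK (toSite r) N (fun κ₁ u₁ => coProjBmAtK (toSite r) N ((fun κ u κ' u' => legCo₂BmAt (toSite r) N (Y κ u κ' u')) κ₁ u₁) κ' u') κ u))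
      = (fun κ u κ' u' => dressKBmAt (toSite r) N (coProjBmAtK (toSite r) N (fun κ₁ u₁ => coProjBmAtK (toSite r) N (Y κ₁ u₁) κ' u') κ u)) := by
  funext κ u κ' u'
  show dressKBmAt (toSite r) N (coProjBmAtK (toSite r) N (fun κ₁ u₁ => coProjBmAtK (toSite r) N (fun κ₂ u₂ => legCo₂BmAt (toSite r) N (Y κ₁ u₁ κ₂ u₂)) κ' u') κ u) = _
  simp only [coProjBmAtK_legCo₂_comm]
  rw [dressKBmAt_eq_legs, dressKBmAt_eq_legs, legCo₁_legCo₂_comm, legCo₂_idem hN hr]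

/-- NOT IN PRINT; OUR BOOKKEEPING.  **`𝔇` ABSORBS THE KERNEL DRESSING OF THE VALUES**: `𝔇 (L Y) = 𝔇 Y` with `L Y := (κ u κ′ u′ ↦ dressKBmAt ρ N (Y κ u κ′ u′))` (in-block root,
`1 ≤ N`; `TableDressingIdempotent.coProjBmAtK_dressKBmAt_comm` + `dressKBmAt_idem`). -/
theorem tableDress_dress (hN : 1 ≤ N) {r : Fin (d + 1) → ℕ} (hr : r ∈ box (d + 1) N) (Y : Tab d) :
    (fun κ u κ' u' => dressKBmAt (toSite r) N (coProjBmAtK (toSite r) N (fun κ₁ u₁ => coProjBmAtK (toSite r) N ((fun κ u κ' u' => dressKBmAt (toSite r) N (Y κ u κ' u')) κ₁ u₁) κ' u') κ u))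
      = (fun κ u κ' u' => dressKBmAt (toSite r) N (coProjBmAtK (toSite r) N (fun κ₁ u₁ => coProjBmAtK (toSite r) N (Y κ₁ u₁) κ' u') κ u)) := by
  funext κ u κ' u'
  show dressKBmAt (toSite r) N (coProjBmAtK (toSite r) N (fun κ₁ u₁ => coProjBmAtK (toSite r) N (fun κ₂ u₂ => dressKBmAt (toSite r) N (Y κ₁ u₁ κ₂ u₂)) κ' u') κ u) = _
  simp only [coProjBmAtK_dressKBmAt_comm]
  rw [dressKBmAt_idem hN hr]

/-- NOT IN PRINT; OUR BOOKKEEPING.  **`𝔇` KILLS THE SECOND-SOURCE-SLOT DEFECT**: `𝔇 (P₂ Y − Y) = 0` (in-block root, `1 ≤ N`, any table). -/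
theorem tableDress_slotDefect_snd_eq_zero (hN : 1 ≤ N) {r : Fin (d + 1) → ℕ} (hr : r ∈ box (d + 1) N) (Y : Tab d) :
    (fun κ u κ' u' => dressKBmAt (toSite r) N (coProjBmAtK (toSite r) N (fun κ₁ u₁ => coProjBmAtK (toSite r) N (((fun κ u => coProjBmAtK (toSite r) N (Y κ u)) - Y) κ₁ u₁) κ' u') κ u)) = 0 := by
  rw [tableDress_sub, tableDress_coProj_snd hN hr, sub_self]

/-- NOT IN PRINT; OUR BOOKKEEPING.  **`𝔇` KILLS THE FIRST-SOURCE-SLOT DEFECT**: `𝔇 (P₁ Y − Y) = 0`. -/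
theorem tableDress_slotDefect_fst_eq_zero (hN : 1 ≤ N) {r : Fin (d + 1) → ℕ} (hr : r ∈ box (d + 1) N) (Y : Tab d) :
    (fun κ u κ' u' => dressKBmAt (toSite r) N (coProjBmAtK (toSite r) N (fun κ₁ u₁ => coProjBmAtK (toSite r) N (((fun κ u κ' u' => coProjBmAtK (toSite r) N (fun κ₁ u₁ => Y κ₁ u₁ κ' u') κ u) - Y) κ₁ u₁) κ' u') κ u)) = 0 := by
  rw [tableDress_sub, tableDress_coProj_fst hN hr, sub_self]

/-- NOT IN PRINT; OUR BOOKKEEPING.  **`𝔇` KILLS THE FIRST-LEG DEFECT**: `𝔇 (L₁ Y − Y) = 0`. -/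
theorem tableDress_slotDefect_legCo₁_eq_zero (hN : 1 ≤ N) {r : Fin (d + 1) → ℕ} (hr : r ∈ box (d + 1) N) (Y : Tab d) :
    (fun κ u κ' u' => dressKBmAt (toSite r) N (coProjBmAtK (toSite r) N (fun κ₁ u₁ => coProjBmAtK (toSite r) N (((fun κ u κ' u' => legCo₁BmAt (toSite r) N (Y κ u κ' u')) - Y) κ₁ u₁) κ' u') κ u)) = 0 := by
  rw [tableDress_sub, tableDress_legCo₁ hN hr, sub_self]

/-- NOT IN PRINT; OUR BOOKKEEPING.  **`𝔇` KILLS THE SECOND-LEG DEFECT**: `𝔇 (L₂ Y − Y) = 0`. -/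
theorem tableDress_slotDefect_legCo₂_eq_zero (hN : 1 ≤ N) {r : Fin (d + 1) → ℕ} (hr : r ∈ box (d + 1) N) (Y : Tab d) :
    (fun κ u κ' u' => dressKBmAt (toSite r) N (coProjBmAtK (toSite r) N (fun κ₁ u₁ => coProjBmAtK (toSite r) N (((fun κ u κ' u' => legCo₂BmAt (toSite r) N (Y κ u κ' u')) - Y) κ₁ u₁) κ' u') κ u)) = 0 := by
  rw [tableDress_sub, tableDress_legCo₂ hN hr, sub_self]

/-- NOT IN PRINT; OUR BOOKKEEPING.  **`𝔇` KILLS THE KERNEL-DRESSING DEFECT**: `𝔇 (L Y − Y) = 0`, `L` the kernel dressing of the values. -/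
theorem tableDress_slotDefect_dress_eq_zero (hN : 1 ≤ N) {r : Fin (d + 1) → ℕ} (hr : r ∈ box (d + 1) N) (Y : Tab d) :
    (fun κ u κ' u' => dressKBmAt (toSite r) N (coProjBmAtK (toSite r) N (fun κ₁ u₁ => coProjBmAtK (toSite r) N (((fun κ u κ' u' => dressKBmAt (toSite r) N (Y κ u κ' u')) - Y) κ₁ u₁) κ' u') κ u)) = 0 := by
  rw [tableDress_sub, tableDress_dress hN hr, sub_self]

/-! ## §5 The dressed linear step annihilates every one-slot defect («(E1) weak form is vacuous») -/

/-- NOT IN PRINT; OUR BOOKKEEPING.  **THE DRESSED LINEAR STEP KILLS THE SECOND-SOURCE-SLOT DEFECT** (decaying `K` at rate `m > 0`, `LocStencil₂ Y CY m`, in-block root, `1 ≤ N`,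
any `c`): `lin4 c (coDressKBmAt ρ N K) N (P₂ Y − Y) = 0` — `𝒜^E = 𝒜^B ∘ 𝔇` (`lin4_coDressKBmAt`) on both tables and §4. -/
theorem lin4_coDressKBmAt_slotDefect_snd_eq_zero (hN : 1 ≤ N) {r : Fin (d + 1) → ℕ} (hr : r ∈ box (d + 1) N)
    {K : MKer (d + 1) (Fib d)} {C m : ℝ} (hK : Decays K C m) (hm : 0 < m) {Y : Tab d} {CY : ℝ} (hY : LocStencil₂ Y CY m) (c : ℝ) :
    lin4 c (coDressKBmAt (toSite r) N K) N ((fun κ u => coProjBmAtK (toSite r) N (Y κ u)) - Y) = 0 := by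
  have hC : 0 ≤ C := hK.nonneg (Sum.inl 0)
  obtain ⟨δ', C', hδ', -, hG⟩ := AxialDressingRooted.decays_coDressKBmAt hN hr (K := K) ⟨m, C, hm, hC, hK⟩
  have hCY : 0 ≤ CY := hY.nonneg
  have hP : LocStencil₂ (fun κ u => coProjBmAtK (toSite r) N (Y κ u)) (cKb d N m * CY) m := locStencil₂_coProj_snd hN hr hY hm.le
  have b1 : ∀ κ u κ' u' x z a b, |(fun κ u => coProjBmAtK (toSite r) N (Y κ u)) κ u κ' u' x z a b| ≤ (cKb d N m + 1) * CY :=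
    fun κ u κ' u' x z a b => (bdd_of_locStencil₂ hP hm.le κ u κ' u' x z a b).trans (by nlinarith [cKb_nonneg d N m])
  have b2 : ∀ κ u κ' u' x z a b, |Y κ u κ' u' x z a b| ≤ (cKb d N m + 1) * CY :=
    fun κ u κ' u' x z a b => (bdd_of_locStencil₂ hY hm.le κ u κ' u' x z a b).trans (by nlinarith [cKb_nonneg d N m])
  rw [lin4_sub hG hδ' c N b1 b2, lin4_coDressKBmAt hN hr hK hm hP c, lin4_coDressKBmAt hN hr hK hm hY c, tableDress_coProj_snd hN hr, sub_self]

/-- NOT IN PRINT; OUR BOOKKEEPING.  **THE DRESSED LINEAR STEP KILLS THE FIRST-SOURCE-SLOT DEFECT**: `lin4 c (coDressKBmAt ρ N K) N (P₁ Y − Y) = 0` (same hypotheses). -/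
theorem lin4_coDressKBmAt_slotDefect_fst_eq_zero (hN : 1 ≤ N) {r : Fin (d + 1) → ℕ} (hr : r ∈ box (d + 1) N)
    {K : MKer (d + 1) (Fib d)} {C m : ℝ} (hK : Decays K C m) (hm : 0 < m) {Y : Tab d} {CY : ℝ} (hY : LocStencil₂ Y CY m) (c : ℝ) :
    lin4 c (coDressKBmAt (toSite r) N K) N ((fun κ u κ' u' => coProjBmAtK (toSite r) N (fun κ₁ u₁ => Y κ₁ u₁ κ' u') κ u) - Y) = 0 := by
  have hC : 0 ≤ C := hK.nonneg (Sum.inl 0)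
  obtain ⟨δ', C', hδ', -, hG⟩ := AxialDressingRooted.decays_coDressKBmAt hN hr (K := K) ⟨m, C, hm, hC, hK⟩
  have hCY : 0 ≤ CY := hY.nonneg
  set κ₁c : ℝ := cWb d N * Real.exp (3 * m * (((d : ℝ) + 1) * N)) with hκ₁c
  have hκ₁c0 : 0 ≤ κ₁c := by rw [hκ₁c]; exact mul_nonneg (cWb_nonneg _ _) (Real.exp_pos _).le
  have hP : LocStencil₂ (fun κ u κ' u' => coProjBmAtK (toSite r) N (fun κ₁ u₁ => Y κ₁ u₁ κ' u') κ u) (κ₁c * CY) m := locStencil₂_coProj_fst hN hr hY hm.le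
  have b1 : ∀ κ u κ' u' x z a b, |(fun κ u κ' u' => coProjBmAtK (toSite r) N (fun κ₁ u₁ => Y κ₁ u₁ κ' u') κ u) κ u κ' u' x z a b| ≤ (κ₁c + 1) * CY :=
    fun κ u κ' u' x z a b => (bdd_of_locStencil₂ hP hm.le κ u κ' u' x z a b).trans (by nlinarith)
  have b2 : ∀ κ u κ' u' x z a b, |Y κ u κ' u' x z a b| ≤ (κ₁c + 1) * CY :=
    fun κ u κ' u' x z a b => (bdd_of_locStencil₂ hY hm.le κ u κ' u' x z a b).trans (by nlinarith)
  rw [lin4_sub hG hδ' c N b1 b2, lin4_coDressKBmAt hN hr hK hm hP c, lin4_coDressKBmAt hN hr hK hm hY c, tableDress_coProj_fst hN hr, sub_self]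

/-- NOT IN PRINT; OUR BOOKKEEPING.  **THE DRESSED LINEAR STEP KILLS THE KERNEL-DRESSING DEFECT**: `lin4 c (coDressKBmAt ρ N K) N (L Y − Y) = 0`, `L` the kernel dressing of the
values (same hypotheses; `LinT2CoDressed.locStencil₂_dress`). -/
theorem lin4_coDressKBmAt_slotDefect_dress_eq_zero (hN : 1 ≤ N) {r : Fin (d + 1) → ℕ} (hr : r ∈ box (d + 1) N)
    {K : MKer (d + 1) (Fib d)} {C m : ℝ} (hK : Decays K C m) (hm : 0 < m) {Y : Tab d} {CY : ℝ} (hY : LocStencil₂ Y CY m) (c : ℝ) :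
    lin4 c (coDressKBmAt (toSite r) N K) N ((fun κ u κ' u' => dressKBmAt (toSite r) N (Y κ u κ' u')) - Y) = 0 := by
  have hC : 0 ≤ C := hK.nonneg (Sum.inl 0)
  obtain ⟨δ', C', hδ', -, hG⟩ := AxialDressingRooted.decays_coDressKBmAt hN hr (K := K) ⟨m, C, hm, hC, hK⟩
  have hCY : 0 ≤ CY := hY.nonneg
  have hP : LocStencil₂ (fun κ u κ' u' => dressKBmAt (toSite r) N (Y κ u κ' u')) (cKb d N m * cKb d N m * CY) m := locStencil₂_dress hN hr hY hm.le
  have b1 : ∀ κ u κ' u' x z a b, |(fun κ u κ' u' => dressKBmAt (toSite r) N (Y κ u κ' u')) κ u κ' u' x z a b| ≤ (cKb d N m * cKb d N m + 1) * CY :=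
    fun κ u κ' u' x z a b => (bdd_of_locStencil₂ hP hm.le κ u κ' u' x z a b).trans (by nlinarith [mul_nonneg (cKb_nonneg d N m) (cKb_nonneg d N m)])
  have b2 : ∀ κ u κ' u' x z a b, |Y κ u κ' u' x z a b| ≤ (cKb d N m * cKb d N m + 1) * CY :=
    fun κ u κ' u' x z a b => (bdd_of_locStencil₂ hY hm.le κ u κ' u' x z a b).trans (by nlinarith [mul_nonneg (cKb_nonneg d N m) (cKb_nonneg d N m)])
  rw [lin4_sub hG hδ' c N b1 b2, lin4_coDressKBmAt hN hr hK hm hP c, lin4_coDressKBmAt hN hr hK hm hY c, tableDress_dress hN hr, sub_self]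

end Summit.QuantumFields.BalabanUV.Beta.GAN24.TableDressingExpansion

end
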